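import Summits.ResolutionOfSingularities.ResolutionOfSingularities.Theorems.HilbertSamuelEliminationSigmaMaxModificationsCorridor3WLadderStrataStrictTransform
import Summits.ResolutionOfSingularities.ResolutionOfSingularities.Theorems.HilbertSamuelEliminationSigmaMaxModificationsCorridor3WLadderBlownUpCentre
import Literature.AlgebraicGeometry.Resolution.StrictTransformBaseChange
import HarnessLib

/-!
# [OURS · L1 W4.2] The STRATA-half of the MOVING W-ladder, tenth layer: kernel (K-ctr) DISPATCHED — «clean members over the centre»
# reduced to its POINT-germ and CURVE-germ cases at the chain point, the dispatch PROVED from CJS Thm. 3.14 (p499700 / F-61)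

Crux chain w42 (`SigmaMaxModifications`, stmt-ResolutionOfSingularities-18506; skeleton `w_ladder` on `SigmaMaxModificationsCorridor3`,
stmt-ResolutionOfSingularities-19249), row «stub-4 → `Moving.Wlow3CharStrataM p`», kernel (K-ctr) `StrataCentreMembersClean` (p516588;
RULINGS v3.14-10 (CJ) «(K-ctr) ASSEMBLY = stub-4»), seat res-L1-w42-stub-4 (gen 4). OURS (cell res-hironaka, slot W4.2); NOT statements
of H. Hironaka's manuscript [Hironaka2017] nor of [CossartJannsenSaito2020]; AI-drafted, weaker than expert review. Every `theorem` is
PROVED, CONDITIONAL on the printed CJS Thm. 3.14 BY NAME in its two renderings `(h314 : CossartJannsenSaito2020_thm_3_14)` (numerical,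
p499700) and `(h314f : Thm314_nearFibre_subsingleton)` (near fibre, F-61 p514197); the open content is the two `def … : Prop` rows
(K-ctr-pt) `StrataPointCentreMembersClean` and (K-ctr-cv) `StrataCurveCentreDominantClean` — the consumer shapes of res-D-pv-038's
point-centre file (p520827, `ProjDir_projLine` + `Thm314_point_locus`, after localisation at `x_n`) and of its announced curve-centre file
(F-65 Thm. 3.6, the relative Thm. 3.14 at `η_D`, `ProjDir_line`, F-64). Helper file `--supports stmt-ResolutionOfSingularities-19249`.

## The dispatch (at a blown-up step of a never-isolated `ē ≤ 2` chain in the (F1) regime)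

Let `Z' ∋ x_{n+1}` be a component of `X_{n+1}(ν)` with `f(Z') ⊆ V(C)`, `A := closure f(Z')` (irreducible closed, `x_n ∈ A ⊆ V(C)`), and
`R̄ = 𝒪_{X_n,x_n}/C_{x_n}` (regular: the centre is regular). EITHER `x_n` has a generisation `a ≠ x_n` in `V(C)` (CURVE germ): then
`1 ≤ dim R̄` (p515327 `one_le_ringKrullDim_quotient_stalkIdeal`), so `e ≤ ē ≤ 2 ≤ dim R̄ + 1` and Thm. 3.14 (near fibre) leaves at most ONE
point of `X_{n+1}(ν)` over `x_n` — a fibre member `A = {x_n}` would be `{x_{n+1}}`, absurd at a never-isolated point; so `A ≠ {x_n}`, and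
`dim R̄ < e ≤ 2` (Thm. 3.14 numerical) forbids a chain `η ⤳ a ⤳ x_n` in `V(C)` (p511345 `two_le_…`), so `A` is a COMPONENT of `V(C)`
through `x_n` — the unique one (`C_{x_n}` is prime, hence its own unique minimal prime): (K-ctr-cv). OR `x_n` has no proper generisation
in `V(C)` (POINT germ): then `A = {x_n}`, `dim R̄ = 0`; `e ≤ 1` leaves at most one point over `x_n` (absurd as before, so no member at
all), and `e = 2` is (K-ctr-pt).

## What is proved

`eq_of_mem_componentsIn_of_isRegular` (components of a regular closed subscheme through a point coincide), `ringKrullDim_quotient_eq_zero_of`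
(no proper generisation in `V(C)` ⇒ `dim R̄ = 0`), the dispatch `strataCentreMembersClean_of_point_curve :
CossartJannsenSaito2020_thm_3_14 → Thm314_nearFibre_subsingleton → StrataPointCentreMembersClean p 3 Q⁎ G⁎ → StrataCurveCentreDominantClean
p 3 Q⁎ G⁎ → StrataCentreMembersClean p 3 Q⁎ G⁎` (`Q⁎ = QNe (QCharRegime p)`, `G⁎ = (ē ≤ 2)`), and the strata row
`wlow3CharStrataM_of_thm_3_14_point_curve_centreIO : h314 → h314f → (K-ctr-pt) → (K-ctr-cv) → (c-geo) → Wlow3CharStrataM p`.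

References: CJS LNM 2270 Thm. 3.14, Rem. 6.29 (1) [CossartJannsenSaito2020]; Stacks 01J7 [StacksProject]; Matsumura Thm. 14.3
[Matsumura1987]; tree `…StrictTransformBaseChange` (`isRegularLocalRing_stalk_quotient_stalkIdeal`, `isPrime_stalkIdeal_of_isRegular_subscheme`),
`…SncStrata`, this seat's p515327 / p516588 / p518012 / p521289.
-/

noncomputable section

-- plan-1/idea-2 module setting kept (namespace `…Corridor3.Moving` re-enters `…Corridor3`)
set_option linter.dupNamespace false

open CategoryTheory AlgebraicGeometry TopologicalSpace Topology IsLocalRing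
open Summit.ResolutionOfSingularities.ResolutionOfSingularities.Theorems.CampaignW42
open Literature.AlgebraicGeometry.Resolution Literature.RingTheory.HilbertSamuel
open Literature.AlgebraicGeometry.CossartJannsenSaito2020
open Summit.ResolutionOfSingularities.ResolutionOfSingularities.Theorems.SigmaMaxModificationsCorridor3

universe u

namespace Summit.ResolutionOfSingularities.ResolutionOfSingularities.Theorems.SigmaMaxModificationsCorridor3.Moving

variable {R : ∀ S : Scheme.{u}, CentreSeq S → Prop} {N : ℕ} {ν : ℕ → ℕ}

/-! ## §1. The two residual rows -/

/-- [OURS · L1 W4.2] **ROW (K-ctr-pt) — POINT GERM OF THE CENTRE AT THE CHAIN POINT, `e = 2`.** Scope as in (K-ctr)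
(`StrataCentreMembersClean`, p516588): from some stage on, at a step whose canonical centre `C` contains `x_n` WITH NO OTHER GENERISATION
OF `x_n` IN `V(C)` (so `{x_n}` is a connected component of the regular `V(C)` and `C_{x_n} = 𝔪_{x_n}`: locally at `x_n` the step is the
blow-up of the closed point) and `e_{x_n}(X_n) = 2`, the components `Z'` of `X_{n+1}(ν)` through `x_{n+1}` with `f(Z') ⊆ {x_n}` number at
most one and are regular curves at `x_{n+1}`. Intended proof: res-D-pv-038's `strataCentreMembersClean_pointCase` (p520827: near points over
`x_n` lie on `ℙ(Dir_{x_n}) ≅ ℙ¹_{k(x_n)}`, `Thm314_point_locus` + `ProjDir_projLine`) after localising the blow-up at `x_n` (Prop. 6.31;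
res-type-053's `BlowupTowerLocalize`). OURS row, OPEN; NOT a statement of the manuscript. -/
def StrataPointCentreMembersClean (p N : ℕ) (Q : ℕ → (ℕ → ℕ) → ∀ X : Scheme.{u}, X → Prop) (G : MarkedStage.{u} → Prop) : Prop :=
  ∀ (R : ∀ S : Scheme.{u}, CentreSeq S → Prop), OracleFunctional R → OracleAdmissible R →
  ∀ (ν : ℕ → ℕ) (X : Scheme.{u}) [IsLocallyNoetherian X] (x : X), IsMaximalOrigin p N ν X x → Q N ν X x →
  ∀ c : ℕ → MarkedStage.{u}, Reaches R N ν (MarkedStage.init X x) (c 0) →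
    (∀ n, CanonicalNearStep R N ν (c n) (c (n + 1))) → (∀ n, G (c n)) → (∀ n, ¬ Iso N (c n)) →
    (∀ n, ∃ m, n ≤ m ∧ (c m).IsBlownUp R N ν) →
    ∃ n₁, ∀ n, n₁ ≤ n → ∀ (C : (c n).W.IdealSheafData) (P' : Option (Pending (blowup C))),
      IsCanonicalStep R N ν (c n).L (c n).P C P' → (c n).pt ∈ (C.support : Set (c n).W) →
      (∀ a ∈ (C.support : Set (c n).W), a ⤳ (c n).pt → a = (c n).pt) → dirDim (c n) = 2 →
      ∀ f : (c (n + 1)).W ⟶ (c n).W, StepProjection R N ν (c n) (c (n + 1)) f →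
        (∀ Z' ∈ componentsThrough N ν (c (n + 1)), ∀ Z'' ∈ componentsThrough N ν (c (n + 1)),
            f.base '' Z' ⊆ {(c n).pt} → f.base '' Z'' ⊆ {(c n).pt} → Z' = Z'') ∧
        ∀ Z' ∈ componentsThrough N ν (c (n + 1)), f.base '' Z' ⊆ {(c n).pt} → IsRegularCurveAt (c (n + 1)) Z'

/-- [OURS · L1 W4.2] **ROW (K-ctr-cv) — CURVE GERM OF THE CENTRE AT THE CHAIN POINT: THE DOMINANT OF THE CENTRE COMPONENT THROUGH
`x_n`.** Scope as in (K-ctr): from some stage on, at every step (canonical centre `C`, step projection `f`), for every irreducible component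
`D` of `V(C)` with `x_n ∈ D ≠ {x_n}`, the components `Z'` of `X_{n+1}(ν)` through `x_{n+1}` DOMINATING `D` (`closure f(Z') = D`) number at
most one and are regular curves at `x_{n+1}`. Intended proof (res-D-pv-038's announced curve-centre file): `D` is a regular curve
(Thm. 3.14 numerical); at its generic point `η`, `e_η ≤ e_{x_n} − 1 ≤ 1` (Thm. 3.6, F-65) and the near points over `η` lie on
`ℙ(Dir_η/T_ηD) = ℙ^0` (relative Thm. 3.14, `ProjDir_line`): one dominant, `k(η)`-rational, hence regular at `x_{n+1}` (finite birational
onto the regular `D`, F-64 / no local ring strictly between a DVR and its fraction field). OURS row, OPEN; NOT a statement of the manuscript. -/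
def StrataCurveCentreDominantClean (p N : ℕ) (Q : ℕ → (ℕ → ℕ) → ∀ X : Scheme.{u}, X → Prop) (G : MarkedStage.{u} → Prop) : Prop :=
  ∀ (R : ∀ S : Scheme.{u}, CentreSeq S → Prop), OracleFunctional R → OracleAdmissible R →
  ∀ (ν : ℕ → ℕ) (X : Scheme.{u}) [IsLocallyNoetherian X] (x : X), IsMaximalOrigin p N ν X x → Q N ν X x →
  ∀ c : ℕ → MarkedStage.{u}, Reaches R N ν (MarkedStage.init X x) (c 0) →
    (∀ n, CanonicalNearStep R N ν (c n) (c (n + 1))) → (∀ n, G (c n)) → (∀ n, ¬ Iso N (c n)) →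
    (∀ n, ∃ m, n ≤ m ∧ (c m).IsBlownUp R N ν) →
    ∃ n₁, ∀ n, n₁ ≤ n → ∀ (C : (c n).W.IdealSheafData) (P' : Option (Pending (blowup C))),
      IsCanonicalStep R N ν (c n).L (c n).P C P' →
      ∀ f : (c (n + 1)).W ⟶ (c n).W, StepProjection R N ν (c n) (c (n + 1)) f →
        ∀ D ∈ componentsIn (C.support : Set (c n).W), (c n).pt ∈ D → D ≠ {(c n).pt} →
          (∀ Z' ∈ componentsThrough N ν (c (n + 1)), ∀ Z'' ∈ componentsThrough N ν (c (n + 1)),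
              closure (f.base '' Z') = D → closure (f.base '' Z'') = D → Z' = Z'') ∧
          ∀ Z' ∈ componentsThrough N ν (c (n + 1)), closure (f.base '' Z') = D → IsRegularCurveAt (c (n + 1)) Z'

/-! ## §2. Two plumbing lemmas -/

/-- **Components of a regular closed subscheme through one point coincide**: `C_x` is prime (the regular `𝒪_{X,x}/C_x` is a domain), hence
its own unique minimal prime, while the generic points of two components of `V(C)` through `x` give minimal primes of `I(V(C))_x = C_x`.
[cite: StacksProject, Tag 01J7] -/
theorem eq_of_mem_componentsIn_of_isRegular {X : Scheme.{u}} [IsLocallyNoetherian X] {C : X.IdealSheafData}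
    (hreg : Scheme.IsRegular C.subscheme) {x : X} {E₁ E₂ : Set X} (hE₁ : E₁ ∈ componentsIn (C.support : Set X))
    (hE₂ : E₂ ∈ componentsIn (C.support : Set X)) (hx₁ : x ∈ E₁) (hx₂ : x ∈ E₂) : E₁ = E₂ := by
  haveI := hreg.isReduced
  -- `C = I(V(C))`
  have hCv : C = Scheme.IdealSheafData.vanishingIdeal C.support := by
    have h1 : C = (⊥ : C.subscheme.IdealSheafData).map C.subschemeι := by
      rw [Scheme.IdealSheafData.map_bot, Scheme.IdealSheafData.ker_subschemeι]
    have h2 : (⊥ : C.subscheme.IdealSheafData) = Scheme.IdealSheafData.vanishingIdeal ⊤ := by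
      rw [Scheme.IdealSheafData.vanishingIdeal_top, Scheme.nilradical_eq_bot]
    rw [h1, h2, Scheme.IdealSheafData.map_vanishingIdeal]
    congr 1
  have hxC : x ∈ C.support := componentsIn.subset hE₁ hx₁
  have hprime : (stalkIdeal C x).IsPrime := isPrime_stalkIdeal_of_isRegular_subscheme hreg hxC
  -- generic points of the components are maximal points of `V(C)`
  have hcl : IsClosed (C.support : Set X) := C.support.isClosed
  have hgen : ∀ {E : Set X}, E ∈ componentsIn (C.support : Set X) →
      ∃ η, IsGenericPoint η E ∧ η ∈ maxPoints (C.support : Set X) := by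
    intro E hE
    have hEirr := componentsIn.isIrreducible hE
    have hEgen : IsGenericPoint hEirr.genericPoint E := hEirr.isGenericPoint_genericPoint (componentsIn.isClosed hcl hE)
    refine ⟨_, hEgen, componentsIn.subset hE hEgen.mem, fun η' hη' hs => ?_⟩
    -- `closure {η'} ⊇ E` is irreducible inside `V(C)`, so equals `E`
    have hsub : E ⊆ closure {η'} := by
      rw [← hEgen.def]; exact closure_minimal (Set.singleton_subset_iff.mpr (specializes_iff_mem_closure.mp hs)) isClosed_closure
    have heq : closure {η'} = E := (((mem_componentsIn_iff.mp hE).2.2 _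
      (closure_minimal (Set.singleton_subset_iff.mpr hη') hcl) isIrreducible_singleton.closure hsub).antisymm hsub)
    have h1 : IsGenericPoint η' E := by rw [← heq]; exact isGenericPoint_closure
    exact (h1.eq hEgen)
  obtain ⟨η₁, hη₁, hm₁⟩ := hgen hE₁
  obtain ⟨η₂, hη₂, hm₂⟩ := hgen hE₂
  have hs₁ : η₁ ⤳ x := hη₁.specializes hx₁
  have hs₂ : η₂ ⤳ x := hη₂.specializes hx₂
  have hp₁ := primeOfSpecializes_mem_minimalPrimes_of_mem_maxPoints (Z := C.support) hm₁ hs₁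
  have hp₂ := primeOfSpecializes_mem_minimalPrimes_of_mem_maxPoints (Z := C.support) hm₂ hs₂
  rw [← hCv, Ideal.minimalPrimes_eq_subsingleton_self] at hp₁ hp₂
  have h12 : primeOfSpecializes hs₁ = primeOfSpecializes hs₂ := by
    rw [Set.mem_singleton_iff.mp hp₁, Set.mem_singleton_iff.mp hp₂]
  have hη : η₁ = η₂ :=
    ((specializes_of_primeOfSpecializes_le hs₂ hs₁ h12.le).antisymm (specializes_of_primeOfSpecializes_le hs₁ hs₂ h12.ge)).eq
  rw [← hη₁.def, ← hη₂.def, hη]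

/-- **No proper generisation of `x` in `V(C)` ⇒ `dim 𝒪_{X,x}/C_x = 0`**: every prime above `C_x` is a point of `V(C)` generising `x`.
[cite: StacksProject, Tag 01J7] -/
theorem ringKrullDim_quotient_le_zero_of_forall_specializes {X : Scheme.{u}} (C : X.IdealSheafData) {x : X}
    (h : ∀ a ∈ (C.support : Set X), a ⤳ x → a = x) :
    ringKrullDim (X.presheaf.stalk x ⧸ stalkIdeal C x) ≤ 0 := by
  rw [ringKrullDim_quotient, Order.krullDim]
  refine iSup_le fun l => ?_
  by_contra hl
  have h1 : 1 ≤ l.length := by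
    by_contra h1
    exact hl (by exact_mod_cast (show l.length ≤ 0 by omega))
  let i₀ : Fin (l.length + 1) := ⟨0, by omega⟩
  let i₁ : Fin (l.length + 1) := ⟨1, by omega⟩
  have h01 : l i₀ < l i₁ := l.strictMono (Fin.mk_lt_mk.mpr (by omega))
  set q₀ := (l i₀).1
  have hJ₀ : stalkIdeal C x ≤ q₀.asIdeal := by
    have := (l i₀).2; rwa [PrimeSpectrum.mem_zeroLocus, SetLike.coe_subset_coe] at this
  have hy₀ := fromSpecStalk_specializes (X := X) (t := x) q₀
  have hp₀ : primeOfSpecializes hy₀ = q₀.asIdeal := primeOfSpecializes_fromSpecStalk q₀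
  have hy₀C : X.fromSpecStalk x q₀ ∈ (C.support : Set X) :=
    (mem_support_iff_stalkIdeal_le_primeOfSpecializes hy₀ C).mpr (hp₀ ▸ hJ₀)
  have heq : X.fromSpecStalk x q₀ = x := h _ hy₀C hy₀
  have hmax : q₀.asIdeal = maximalIdeal _ := by
    rw [← hp₀]
    have : primeOfSpecializes hy₀ = primeOfSpecializes (specializes_refl x) := by congr 1
    rw [this, Literature.AlgebraicGeometry.Resolution.primeOfSpecializes_refl]
  have hlt : q₀.asIdeal < (l i₁).1.asIdeal := h01
  exact hlt.ne (le_antisymm hlt.le (hmax ▸ le_maximalIdeal (l i₁).1.2.ne_top))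


/-! ## §3. The dispatch -/

/-- **KERNEL (K-ctr) FROM ITS POINT-GERM AND CURVE-GERM CASES** (conditional on the printed Thm. 3.14 in its two renderings, by name;
`N = 3`, `Q = QNe (QCharRegime p)`, `G = (ē ≤ 2)`): the dispatch of the module docstring.
[cite: CossartJannsenSaito2020, Thm. 3.14, Def. 3.1, Rem. 6.29 (1)] -/
theorem strataCentreMembersClean_of_point_curve {p : ℕ} (h314 : CossartJannsenSaito2020_thm_3_14.{u})
    (h314f : Thm314_nearFibre_subsingleton.{u})
    (hpt : StrataPointCentreMembersClean.{u} p 3 (QNe (Helpers.QCharRegime p)) fun s => s.geomDirDim ≤ 2)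
    (hcv : StrataCurveCentreDominantClean.{u} p 3 (QNe (Helpers.QCharRegime p)) fun s => s.geomDirDim ≤ 2) :
    StrataCentreMembersClean.{u} p 3 (QNe (Helpers.QCharRegime p)) fun s => s.geomDirDim ≤ 2 := by
  intro R hRf hRa ν X _ x hX hQ c h0 hstep hG hnI hmov
  obtain ⟨n₁, hn₁⟩ := hpt R hRf hRa ν X x hX hQ c h0 hstep hG hnI hmov
  obtain ⟨n₂, hn₂⟩ := hcv R hRf hRa ν X x hX hQ c h0 hstep hG hnI hmov
  obtain ⟨hq, hν⟩ := hQ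
  obtain ⟨k, _, _, g, -, hft, hqc⟩ := hX.exists_structure
  haveI := hft
  haveI := hqc
  haveI := hX.isReduced
  obtain ⟨-, k', _, hinv⟩ := exists_cycleInv_chain' hRf hRa hX h0 hstep
  refine ⟨max n₁ n₂, fun n hn C P' hcs hxC f hf => ?_⟩
  -- standing facts at stage `n`
  have hgood : StateGood k R 3 ν (c n).W (c n).L (c n).P :=
    stateGood_of_reaches (stateGood_init_general hRa g hX.dim_le hX.maximal hν) (reaches_chain h0 hstep n)
  have hchar : CharHypothesis (c n).W (c n).pt := charHypothesis_of_qCharRegime hX hq (reaches_chain h0 hstep n) hgood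
  haveI : IsLocallyNoetherian (c n).W := (c n).ln
  haveI : IsNoetherian (c n).W := (hinv n).isNoetherian
  have hptn : (c n).pt ∈ Scheme.hsStratum (c n).W 3 ν := pt_mem_hsStratum_of_reaches hX.mem_stratum (reaches_chain h0 hstep n)
  have hptcl : IsClosed ({(c n).pt} : Set (c n).W) := Reaches.isClosed_pt hX.isClosed (reaches_chain h0 hstep n)
  have hpt' : (c (n + 1)).pt ∈ Scheme.hsStratum (c (n + 1)).W 3 ν :=
    pt_mem_hsStratum_of_reaches hX.mem_stratum (reaches_chain h0 hstep (n + 1))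
  obtain ⟨hCreg, -, -, -⟩ := (hinv n).centre hRa hν hcs
  -- Thm. 3.14 numerical at this step, and `e ≤ ē ≤ 2`
  have h314n := centreDim_lt_dirDim_of_isBlownUp h314 hRf hgood hptn (hstep n) hchar hcs hxC
  have he2 : (dirDim (c n) : WithBot ℕ∞) ≤ 2 := by
    have h1 : dirDim (c n) ≤ 2 := (Scheme.dirDim_le_geomDirDim (c n).pt).trans (hG n)
    exact_mod_cast h1
  -- the image closure of a member: irreducible closed, through `x_n`, inside `V(C)`
  have hA : ∀ Z' ∈ componentsThrough 3 ν (c (n + 1)), f.base '' Z' ⊆ (C.support : Set (c n).W) →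
      IsIrreducible (closure (f.base '' Z')) ∧ (c n).pt ∈ closure (f.base '' Z') ∧
        closure (f.base '' Z') ⊆ (C.support : Set (c n).W) := fun Z' hZ' hZ'C =>
    ⟨((componentsIn.isIrreducible hZ'.1).image _ f.continuous.continuousOn).closure,
      subset_closure ⟨_, hZ'.2, hf.base_pt⟩, closure_minimal hZ'C C.support.isClosed⟩
  -- a member inside the NEAR FIBRE is impossible at a never-isolated point
  have hnofibre : (dirDim (c n) : WithBot ℕ∞) ≤ ringKrullDim ((c n).W.presheaf.stalk (c n).pt ⧸ stalkIdeal C (c n).pt) + 1 →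
      ∀ Z' ∈ componentsThrough 3 ν (c (n + 1)), f.base '' Z' ⊆ {(c n).pt} → False := by
    intro he Z' hZ' hZ'x
    have hsub := hf.nearFibre_subsingleton h314f hRf hcs hgood.isExcellent (hgood.isPermissible hcs) hgood.dim_le hxC hchar hptn he
    have hZ'fib : Z' ⊆ {z : (c (n + 1)).W | f.base z = (c n).pt ∧ z ∈ Scheme.hsStratum (c (n + 1)).W 3 ν} :=
      fun z hz => ⟨hZ'x ⟨z, hz, rfl⟩, componentsIn.subset hZ'.1 hz⟩
    have hZ'eq : Z' = {(c (n + 1)).pt} :=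
      Set.Subset.antisymm (fun z hz => hsub (hZ'fib hz) (hZ'fib hZ'.2)) (Set.singleton_subset_iff.mpr hZ'.2)
    exact (hinv (n + 1)).singleton_notMem_componentsIn_of_not_iso hpt' (hnI (n + 1)) (hZ'eq ▸ hZ'.1)
  by_cases hgerm : ∀ a ∈ (C.support : Set (c n).W), a ⤳ (c n).pt → a = (c n).pt
  · -- POINT germ: every member lies over `x_n`
    have hover : ∀ Z' ∈ componentsThrough 3 ν (c (n + 1)), f.base '' Z' ⊆ (C.support : Set (c n).W) →
        f.base '' Z' ⊆ {(c n).pt} := by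
      intro Z' hZ' hZ'C
      obtain ⟨hirr, hxA, hAC⟩ := hA Z' hZ' hZ'C
      have hgen : IsGenericPoint hirr.genericPoint (closure (f.base '' Z')) := hirr.isGenericPoint_genericPoint isClosed_closure
      have ha : hirr.genericPoint = (c n).pt := hgerm _ (hAC hgen.mem) (hgen.specializes hxA)
      have hAeq : closure (f.base '' Z') = {(c n).pt} := by rw [← hgen.def, ha, hptcl.closure_eq]
      exact subset_closure.trans hAeq.le
    by_cases he : dirDim (c n) = 2
    · obtain ⟨hu, hr⟩ := hn₁ n (le_of_max_le_left hn) C P' hcs hxC hgerm he f hf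
      exact ⟨fun Z' hZ' Z'' hZ'' h' h'' => hu Z' hZ' Z'' hZ'' (hover Z' hZ' h') (hover Z'' hZ'' h''),
        fun Z' hZ' h' => hr Z' hZ' (hover Z' hZ' h')⟩
    · -- `e ≤ 1`: no member at all
      have hdim0 := ringKrullDim_quotient_le_zero_of_forall_specializes C hgerm
      have hJm : stalkIdeal C (c n).pt ≤ maximalIdeal ((c n).W.presheaf.stalk (c n).pt) := by
        have := (mem_support_iff_stalkIdeal_le_primeOfSpecializes (specializes_refl (c n).pt) C).mp hxC
        rwa [Literature.AlgebraicGeometry.Resolution.primeOfSpecializes_refl] at this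
      have hJtop : stalkIdeal C (c n).pt ≠ ⊤ := fun h =>
        (maximalIdeal.isMaximal ((c n).W.presheaf.stalk (c n).pt)).ne_top (top_le_iff.mp (h ▸ hJm))
      haveI : Nontrivial ((c n).W.presheaf.stalk (c n).pt ⧸ stalkIdeal C (c n).pt) :=
        Ideal.Quotient.nontrivial_iff.mpr hJtop
      have hle : (dirDim (c n) : WithBot ℕ∞) ≤
          ringKrullDim ((c n).W.presheaf.stalk (c n).pt ⧸ stalkIdeal C (c n).pt) + 1 := by
        have h1 : dirDim (c n) ≤ 1 := by
          have : dirDim (c n) ≤ 2 := (Scheme.dirDim_le_geomDirDim (c n).pt).trans (hG n)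
          omega
        have h1' : (dirDim (c n) : WithBot ℕ∞) ≤ 1 := by exact_mod_cast h1
        have h0 : (0 : WithBot ℕ∞) ≤ ringKrullDim ((c n).W.presheaf.stalk (c n).pt ⧸ stalkIdeal C (c n).pt) :=
          ringKrullDim_nonneg_of_nontrivial
        calc (dirDim (c n) : WithBot ℕ∞) ≤ 0 + 1 := by simpa using h1'
          _ ≤ _ := add_le_add h0 le_rfl
      exact ⟨fun Z' hZ' _ _ h' _ => (hnofibre hle Z' hZ' (hover Z' hZ' h')).elim,
        fun Z' hZ' h' => (hnofibre hle Z' hZ' (hover Z' hZ' h')).elim⟩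
  · -- CURVE germ: `1 ≤ dim 𝒪_{V(C),x_n}`, no fibre member, members dominate THE component of `V(C)` through `x_n`
    push Not at hgerm
    obtain ⟨a, haC, hax, hane⟩ := hgerm
    have h1 : (1 : WithBot ℕ∞) ≤ ringKrullDim ((c n).W.presheaf.stalk (c n).pt ⧸ stalkIdeal C (c n).pt) :=
      one_le_ringKrullDim_quotient_stalkIdeal C hax hane haC
    have hle : (dirDim (c n) : WithBot ℕ∞) ≤ ringKrullDim ((c n).W.presheaf.stalk (c n).pt ⧸ stalkIdeal C (c n).pt) + 1 := by
      refine he2.trans ?_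
      have h2 : (2 : WithBot ℕ∞) = 1 + 1 := by norm_num
      rw [h2]
      exact add_le_add h1 le_rfl
    have hlt2 : ringKrullDim ((c n).W.presheaf.stalk (c n).pt ⧸ stalkIdeal C (c n).pt) < 2 := h314n.trans_le he2
    -- the image closure of a member is a component of `V(C)` through `x_n`, not `{x_n}`
    have hcomp : ∀ Z' ∈ componentsThrough 3 ν (c (n + 1)), f.base '' Z' ⊆ (C.support : Set (c n).W) →
        closure (f.base '' Z') ∈ componentsIn (C.support : Set (c n).W) ∧ closure (f.base '' Z') ≠ {(c n).pt} := by
      intro Z' hZ' hZ'C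
      obtain ⟨hirr, hxA, hAC⟩ := hA Z' hZ' hZ'C
      have hne : closure (f.base '' Z') ≠ {(c n).pt} := fun heq =>
        hnofibre hle Z' hZ' (subset_closure.trans heq.le)
      refine ⟨?_, hne⟩
      obtain ⟨D, hD, hAD⟩ := exists_componentsIn_superset C.support.isClosed (componentsIn.finite _) hirr hAC
      by_contra hnot
      have hAD' : closure (f.base '' Z') ≠ D := fun h => hnot (h ▸ hD)
      have hDirr : IsIrreducible D := componentsIn.isIrreducible hD
      have hDcl : IsClosed D := componentsIn.isClosed C.support.isClosed hD
      have hAgen : IsGenericPoint hirr.genericPoint (closure (f.base '' Z')) := hirr.isGenericPoint_genericPoint isClosed_closure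
      have hDgen : IsGenericPoint hDirr.genericPoint D := hDirr.isGenericPoint_genericPoint hDcl
      have hbx : hirr.genericPoint ⤳ (c n).pt := hAgen.specializes hxA
      have hηb : hDirr.genericPoint ⤳ hirr.genericPoint := hDgen.specializes (hAD hAgen.mem)
      have hne₁ : hirr.genericPoint ≠ (c n).pt := by
        intro h; apply hne; rw [← hAgen.def, h, hptcl.closure_eq]
      have hne₂ : hDirr.genericPoint ≠ hirr.genericPoint := by
        intro h; apply hAD'; rw [← hAgen.def, ← hDgen.def, h]
      have h2 := two_le_ringKrullDim_quotient_stalkIdeal C hbx hηb hne₁ hne₂ ((componentsIn.subset hD) hDgen.mem) (hAC hAgen.mem)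
      exact absurd (h2.trans_lt hlt2) (lt_irrefl _)
    refine ⟨fun Z' hZ' Z'' hZ'' h' h'' => ?_, fun Z' hZ' h' => ?_⟩
    · obtain ⟨hc', hne'⟩ := hcomp Z' hZ' h'
      obtain ⟨hc'', -⟩ := hcomp Z'' hZ'' h''
      have heq : closure (f.base '' Z') = closure (f.base '' Z'') :=
        eq_of_mem_componentsIn_of_isRegular hCreg hc' hc'' (hA Z' hZ' h').2.1 (hA Z'' hZ'' h'').2.1
      exact (hn₂ n (le_of_max_le_right hn) C P' hcs f hf _ hc' (hA Z' hZ' h').2.1 hne').1 Z' hZ' Z'' hZ'' rfl heq.symm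
    · obtain ⟨hc', hne'⟩ := hcomp Z' hZ' h'
      exact (hn₂ n (le_of_max_le_right hn) C P' hcs f hf _ hc' (hA Z' hZ' h').2.1 hne').2 Z' hZ' rfl

/-! ## §4. The strata-half and the char row, with (K-ctr) dispatched -/

/-- **`Wlow3CharStrataM p` (G1′) FROM the printed Thm. 3.14 (two renderings), (K-ctr-pt), (K-ctr-cv) and the dimension-two kernel
(c-geo).** [cite: CossartJannsenSaito2020, Thm. 3.14, Thm. 6.35, Rem. 6.29 (1)] -/
theorem wlow3CharStrataM_of_thm_3_14_point_curve_centreIO {p : ℕ} (h314 : CossartJannsenSaito2020_thm_3_14.{0})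
    (h314f : Thm314_nearFibre_subsingleton.{0})
    (hpt : StrataPointCentreMembersClean.{0} p 3 (QNe (Helpers.QCharRegime p)) fun s => s.geomDirDim ≤ 2)
    (hcv : StrataCurveCentreDominantClean.{0} p 3 (QNe (Helpers.QCharRegime p)) fun s => s.geomDirDim ≤ 2)
    (hgeo : StrataLineageInCentreIO.{0} p 3 (QNe (Helpers.QCharRegime p)) fun s => s.geomDirDim ≤ 2) :
    Wlow3CharStrataM p :=
  wlow3CharStrataM_of_thm_3_14_nearFibre_centreIO_centreMembersClean h314 h314f hgeo
    (strataCentreMembersClean_of_point_curve h314 h314f hpt hcv)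

/-- The strata row implies (K-ctr-pt) and (K-ctr-cv) (vacuously): the decomposition stays EXACT given the two renderings of
Thm. 3.14. [folklore] -/
theorem wlow3CharStrataM_iff_point_curve_centreIO_of_thm_3_14 {p : ℕ} (h314 : CossartJannsenSaito2020_thm_3_14.{0})
    (h314f : Thm314_nearFibre_subsingleton.{0}) :
    Wlow3CharStrataM p ↔
      (StrataPointCentreMembersClean.{0} p 3 (QNe (Helpers.QCharRegime p)) fun s => s.geomDirDim ≤ 2) ∧
        (StrataCurveCentreDominantClean.{0} p 3 (QNe (Helpers.QCharRegime p)) fun s => s.geomDirDim ≤ 2) ∧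
          StrataLineageInCentreIO.{0} p 3 (QNe (Helpers.QCharRegime p)) fun s => s.geomDirDim ≤ 2 := by
  refine ⟨fun h => ?_, fun ⟨hpt, hcv, hgeo⟩ => wlow3CharStrataM_of_thm_3_14_point_curve_centreIO h314 h314f hpt hcv hgeo⟩
  have h' := maxOriginNoMovingNearChainAtQ_qNe_of_q
    (show MaxOriginNoMovingNearChainAtQ.{0} p 3 (Helpers.QCharRegime p) (fun s => s.geomDirDim ≤ 2 ∧ ¬ Iso 3 s) from h)
  refine ⟨fun R hRf hRa ν X _ x hX hQ c h0 hstep hG hnI hmov =>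
      (h' R hRf hRa ν X x hX hQ ⟨c, h0, hstep, fun n => ⟨hG n, hnI n⟩, hmov⟩).elim,
    fun R hRf hRa ν X _ x hX hQ c h0 hstep hG hnI hmov =>
      (h' R hRf hRa ν X x hX hQ ⟨c, h0, hstep, fun n => ⟨hG n, hnI n⟩, hmov⟩).elim,
    ((wlow3CharStrataM_iff_centreIO_cycleStartRegular_of_thm_3_14 h314 h314f).mp h).1⟩

end Summit.ResolutionOfSingularities.ResolutionOfSingularities.Theorems.SigmaMaxModificationsCorridor3.Moving

end
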